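import Mathlib
import Summits.Ventures.HodgeRepro0.P5LatticeClosureCertDefs

/-!
# p5 — the certificate predicate for «[H_M : L_M] = 1» at a degree M (Theorem A / A′ of the lattice-closure notes)

For a degree M (proofs/P1-FermatLatticeClosure-v1.2.md l.4 / l.7; the 121–180 sibling), with n = ⌊M/2⌋:
* `oddVec M ms` is the odd vector s(x) of a multiset x of residues mod M (s_a = c_a − c_{M−a} for 1 ≤ a < M/2, s_{M/2} = c_{M/2});
* `L M` is the ℤ-span of the odd vectors of the legitimate blocks — `Block.Legit M b` being the COMMITTED predicate of
  P5LatticeClosureCertDefs (Hodge 4-multisets, split Hodge 6-multisets, Aoki's σ_{p,i} of every level m′ | M pulled back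
  by M/m′, unit translates, cancelling pairs; the pair (M/2, M/2) has odd vector 2e_{M/2}) — the lattice L_M of the note;
* `Wt M` is the weight-constraint matrix of the note's H_M in augmented form on ℤ^{n+1}: one row
  (2(ta mod M) − M)_{1 ≤ a ≤ n} for every unit t < M/2, with a 0 in the last column, and the parity row (1, …, 1, −2):
  a vector (s, u) is in its kernel iff s satisfies every weight constraint and Σ_a s_a = 2u, i.e. iff s is the odd vector
  of a Hodge multiset (of even size) — so `proj v`, v ∈ ker Wt M, ranges over exactly the note's H_M.

`index_one_of_cert` turns finite, decidable data into the universal statement `∀ v, Wt M *ᵥ v = 0 → proj v ∈ L M`: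
(i) a GENERATION CERTIFICATE — integer list-matrices HT (the generators, transposed), DT, C, WT with
HT·DTᵀ + C·WTᵀ = 1 (checked row by row, `sumRow` = `idRow`) and μ·W′ = G·Wt M (`smulL` = `prodRow`), whence every kernel
vector v equals HT *ᵥ (DTᵀ *ᵥ v), an integer combination of the generators (`kernel_gen`, `kernel_of_link`);
(ii) for every generator an explicit ℤ-combination of legitimate block odd vectors (`comboVecL`), decided.
Nothing here is Hodge-theoretic: the note's Proposition 2 and Lemma 1 (d) (Shioda 1979 / 1981, Aoki 1987) carry the
blocks to algebraic classes; this file certifies the lattice arithmetic only. R-5 supporting artefact, never a declaration.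
-/

namespace HodgeRepro0.P5.DegreeIndexCert

open HodgeRepro0.P5.LatticeClosureCert
open scoped Matrix

/-! ### Lists as vectors and matrices -/

/-- a list as a vector on `Fin n` (0 beyond the length) -/
def toFun (n : ℕ) (l : List ℤ) : Fin n → ℤ := fun i => l.getD i 0

/-- a list of rows as an r × c matrix (0 beyond the lengths) -/
def matOf (r c : ℕ) (A : List (List ℤ)) : Matrix (Fin r) (Fin c) ℤ :=
  Matrix.of fun i j => (A.getD i []).getD j 0

/-- entrywise sum -/
def addL (a b : List ℤ) : List ℤ := List.zipWith (· + ·) a b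

/-- scalar multiple -/
def smulL (c : ℤ) (a : List ℤ) : List ℤ := a.map (c * ·)

/-- dot product -/
def dotL (a b : List ℤ) : ℤ := (List.zipWith (· * ·) a b).sum

/-- the transpose of a list matrix with r rows and c columns: c rows of length r -/
def transposeL (A : List (List ℤ)) (c r : ℕ) : List (List ℤ) :=
  (List.range c).map fun j => (List.range r).map fun i => (A.getD i []).getD j 0

/-- row i of the c × c identity -/
def idRow (c i : ℕ) : List ℤ := (List.range c).map fun k => if i = k then 1 else 0

/-- row i of A·Bᵀ + C·Dᵀ (A, B, C, D given by rows; c columns) -/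
def sumRow (A B C D : List (List ℤ)) (c i : ℕ) : List ℤ :=
  (List.range c).map fun k => dotL (A.getD i []) (B.getD k []) + dotL (C.getD i []) (D.getD k [])

/-- row i of G·B (G with m columns, B with m rows and c columns) -/
def prodRow (G B : List (List ℤ)) (m c i : ℕ) : List ℤ :=
  (List.range c).map fun a => ((List.range m).map fun j => (G.getD i []).getD j 0 * (B.getD j []).getD a 0).sum

/-- `Lens A r c`: A has r rows, every row of length c -/
def Lens (A : List (List ℤ)) (r c : ℕ) : Prop := A.length = r ∧ ∀ x ∈ A, x.length = c

/-- `Lens` is decidable -/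
instance (A : List (List ℤ)) (r c : ℕ) : Decidable (Lens A r c) := by delta Lens; infer_instance

/-! ### The weight constraints and the lattice L_M -/

/-- the units t of ℤ/M with 2t < M (one of each pair ±t) -/
def unitReps (M : ℕ) : List ℕ := (List.range M).filter fun t => 0 < t ∧ 2 * t < M ∧ Nat.gcd t M = 1

/-- the weight-constraint row of the unit t: (2(ta mod M) − M)_{1 ≤ a ≤ ⌊M/2⌋} -/
def wRow (M t : ℕ) : List ℤ := (List.range (M / 2)).map fun i => 2 * ((t * (i + 1) % M : ℕ) : ℤ) - (M : ℤ)

/-- the augmented constraint rows: every weight row with a trailing 0, then the parity row (1, …, 1, −2) -/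
def augRows (M : ℕ) : List (List ℤ) :=
  (unitReps M).map (fun t => wRow M t ++ [0]) ++ [List.replicate (M / 2) (1 : ℤ) ++ [-2]]

/-- the number of augmented rows -/
def kk (M : ℕ) : ℕ := (unitReps M).length + 1

/-- the augmented weight matrix on ℤ^{⌊M/2⌋+1} -/
def Wt (M : ℕ) : Matrix (Fin (kk M)) (Fin (M / 2 + 1)) ℤ := matOf (kk M) (M / 2 + 1) (augRows M)

/-- the projection (s, u) ↦ s -/
def proj {n : ℕ} (v : Fin (n + 1) → ℤ) : Fin n → ℤ := fun a => v a.castSucc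

/-- the odd vector of a multiset of residues mod M, as a list of length ⌊M/2⌋:
s_a = c_a − c_{M−a} for 2a ≠ M, s_{M/2} = c_{M/2} -/
def oddVecL (M : ℕ) (ms : List ℕ) : List ℤ :=
  (List.range (M / 2)).map fun i =>
    if 2 * (i + 1) = M then ((ms.countP fun x => x % M = i + 1 : ℕ) : ℤ)
    else ((ms.countP fun x => x % M = i + 1 : ℕ) : ℤ) - ((ms.countP fun x => x % M = M - (i + 1) : ℕ) : ℤ)

/-- the odd vector as a function on `Fin ⌊M/2⌋` -/
def oddVec (M : ℕ) (ms : List ℕ) : Fin (M / 2) → ℤ := toFun (M / 2) (oddVecL M ms)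

/-- the lattice L_M: the ℤ-span of the odd vectors of the legitimate blocks at level M -/
def L (M : ℕ) : Submodule ℤ (Fin (M / 2) → ℤ) :=
  Submodule.span ℤ {v | ∃ b : Block, Block.Legit M b ∧ v = oddVec M b.multiset}

/-- the vector Σ c • s(β) of a list of (coefficient, block) pairs, as a list of length ⌊M/2⌋ -/
def comboVecL (M : ℕ) (l : List (ℤ × Block)) : List ℤ :=
  l.foldr (fun p acc => addL (smulL p.1 (oddVecL M p.2.multiset)) acc) (List.replicate (M / 2) 0)

/-! ### List lemmas -/

/-- `getD` of a map over `List.range` -/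
theorem getD_map_range {α : Type*} (f : ℕ → α) (c k : ℕ) (hk : k < c) (d : α) :
    ((List.range c).map f).getD k d = f k := by
  rw [List.getD_eq_getElem?_getD, List.getElem?_map, List.getElem?_range hk]
  rfl

/-- the sum of a map over `List.range m` is the sum over `Fin m` -/
theorem sum_map_range (f : ℕ → ℤ) (m : ℕ) : ((List.range m).map f).sum = ∑ j : Fin m, f j := by
  rw [← Finset.sum_range]
  induction m with
  | zero => simp
  | succ m ih => rw [List.range_succ, List.map_append, List.sum_append, ih, Finset.sum_range_succ]; simp

/-- `getD` commutes with a map fixing 0 -/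
theorem getD_map_zero (f : ℤ → ℤ) (hf : f 0 = 0) (l : List ℤ) (a : ℕ) :
    (l.map f).getD a 0 = f (l.getD a 0) := by
  rw [List.getD_eq_getElem?_getD, List.getD_eq_getElem?_getD, List.getElem?_map]
  cases l[a]? <;> simp [hf]

/-- the dot product of two lists of length r is the sum over `Fin r` -/
theorem dotL_eq_sum (r : ℕ) : ∀ (a b : List ℤ), a.length = r → b.length = r →
    dotL a b = ∑ j : Fin r, a.getD j 0 * b.getD j 0 := by
  induction r with
  | zero =>
    intro a b ha hb
    rw [List.length_eq_zero_iff] at ha hb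
    subst ha; subst hb; simp [dotL]
  | succ r ih =>
    intro a b ha hb
    match a, b with
    | [], _ => simp at ha
    | _, [] => simp at hb
    | x :: a', y :: b' =>
      simp only [List.length_cons, Nat.add_right_cancel_iff] at ha hb
      rw [Fin.sum_univ_succ]
      simp only [dotL, List.zipWith_cons_cons, List.sum_cons, Fin.val_zero, List.getD_cons_zero,
        Fin.val_succ, List.getD_cons_succ]
      rw [← ih a' b' ha hb]
      rfl

/-- `getD` of an entrywise sum -/
theorem getD_addL (a b : List ℤ) : ∀ (i : ℕ), i < a.length → i < b.length →
    (addL a b).getD i 0 = a.getD i 0 + b.getD i 0 := by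
  induction a generalizing b with
  | nil => intro i h; simp at h
  | cons x a' ih =>
    intro i ha hb
    match b, i with
    | [], _ => simp at hb
    | y :: b', 0 => simp [addL]
    | y :: b', i + 1 =>
      simp only [List.length_cons, Nat.add_lt_add_iff_right] at ha hb
      simp only [addL, List.zipWith_cons_cons, List.getD_cons_succ]
      exact ih b' i ha hb

/-- the length of an entrywise sum -/
theorem length_addL (a b : List ℤ) : (addL a b).length = min a.length b.length := by
  simp [addL]

/-- the length of a scalar multiple -/
theorem length_smulL (c : ℤ) (a : List ℤ) : (smulL c a).length = a.length := by simp [smulL]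

/-- the odd vector has length ⌊M/2⌋ -/
theorem length_oddVecL (M : ℕ) (ms : List ℕ) : (oddVecL M ms).length = M / 2 := by simp [oddVecL]

/-- a block combination has length ⌊M/2⌋ -/
theorem length_comboVecL (M : ℕ) (l : List (ℤ × Block)) : (comboVecL M l).length = M / 2 := by
  induction l with
  | nil => simp [comboVecL]
  | cons p l ih =>
    simp only [comboVecL, List.foldr_cons] at ih ⊢
    rw [length_addL, length_smulL, length_oddVecL, ih, min_self]

/-- the transposed list matrix has c rows -/
theorem length_transposeL (A : List (List ℤ)) (c r : ℕ) : (transposeL A c r).length = c := by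
  simp [transposeL]

/-- every row of the transposed list matrix has length r -/
theorem mem_transposeL_length (A : List (List ℤ)) (c r : ℕ) : ∀ x ∈ transposeL A c r, x.length = r := by
  intro x hx
  simp only [transposeL, List.mem_map, List.mem_range] at hx
  obtain ⟨j, _, rfl⟩ := hx
  simp

/-- the rows of a `Lens` matrix have the stated length -/
theorem getD_of_mem_length {A : List (List ℤ)} {r c : ℕ} (h : Lens A r c) (i : ℕ) (hi : i < r) :
    (A.getD i []).length = c := by
  obtain ⟨hl, hr⟩ := h
  rw [List.getD_eq_getElem?_getD]
  have : i < A.length := by omega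
  rw [List.getElem?_eq_getElem this]
  exact hr _ (List.getElem_mem this)

/-! ### Bridges from list identities to matrix identities -/

/-- the transposed list matrix is the transposed matrix -/
theorem matOf_transposeL (A : List (List ℤ)) (c r : ℕ) :
    matOf c r (transposeL A c r) = (matOf r c A)ᵀ := by
  ext j i
  simp only [matOf, Matrix.of_apply, Matrix.transpose_apply, transposeL]
  rw [getD_map_range _ c j j.2, getD_map_range _ r i i.2]

/-- row facts `sumRow = idRow` give the matrix identity A·Bᵀ + C·Dᵀ = 1 -/
theorem identity_of_rows (A B C D : List (List ℤ)) (c r k' : ℕ)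
    (hA : Lens A c r) (hB : Lens B c r) (hC : Lens C c k') (hD : Lens D c k')
    (h : ∀ i < c, sumRow A B C D c i = idRow c i) :
    matOf c r A * (matOf c r B)ᵀ + matOf c k' C * (matOf c k' D)ᵀ = 1 := by
  ext i k
  have hi := congrArg (fun l => l.getD k 0) (h i i.2)
  simp only [sumRow, idRow] at hi
  rw [getD_map_range _ c k k.2, getD_map_range _ c k k.2] at hi
  rw [dotL_eq_sum r _ _ (getD_of_mem_length hA i i.2) (getD_of_mem_length hB k k.2),
    dotL_eq_sum k' _ _ (getD_of_mem_length hC i i.2) (getD_of_mem_length hD k k.2)] at hi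
  rw [Matrix.add_apply, Matrix.mul_apply, Matrix.mul_apply, Matrix.one_apply]
  simp only [matOf, Matrix.of_apply, Matrix.transpose_apply]
  rw [hi]
  by_cases hik : i = k
  · subst hik; simp
  · rw [if_neg hik, if_neg (fun h => hik (Fin.ext h))]

/-- row facts `smulL μ (row i of W) = prodRow G B i` give μ • W = G·B -/
theorem smul_eq_mul_of_rows (W G B : List (List ℤ)) (k' m c : ℕ) (μ : ℤ)
    (h : ∀ i < k', smulL μ (W.getD i []) = prodRow G B m c i) :
    μ • matOf k' c W = matOf k' m G * matOf m c B := by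
  ext i a
  have hi := congrArg (fun l => l.getD a 0) (h i i.2)
  simp only [prodRow] at hi
  rw [getD_map_range _ c a a.2, sum_map_range] at hi
  rw [Matrix.smul_apply, Matrix.mul_apply]
  simp only [matOf, Matrix.of_apply, smul_eq_mul]
  rw [← hi, smulL, getD_map_zero _ (mul_zero μ)]

/-! ### The generation lemma -/

/-- if HT·D + C·W′ = 1 then every vector killed by W′ is HT *ᵥ (D *ᵥ v) -/
theorem kernel_gen {r c k' : ℕ} (HT : Matrix (Fin c) (Fin r) ℤ) (D : Matrix (Fin r) (Fin c) ℤ)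
    (C : Matrix (Fin c) (Fin k') ℤ) (W' : Matrix (Fin k') (Fin c) ℤ) (hI : HT * D + C * W' = 1)
    (v : Fin c → ℤ) (hv : W' *ᵥ v = 0) : v = HT *ᵥ (D *ᵥ v) := by
  have h := congrArg (fun A => A *ᵥ v) hI
  simp only [Matrix.add_mulVec, Matrix.one_mulVec, ← Matrix.mulVec_mulVec, hv, Matrix.mulVec_zero,
    add_zero] at h
  exact h.symm

/-- if μ • W′ = G·W with μ ≠ 0 then the kernel of W lies in the kernel of W′ -/
theorem kernel_of_link {k' m c : ℕ} (W' : Matrix (Fin k') (Fin c) ℤ) (G : Matrix (Fin k') (Fin m) ℤ)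
    (W : Matrix (Fin m) (Fin c) ℤ) (μ : ℤ) (hμ : μ ≠ 0) (hG : μ • W' = G * W) (v : Fin c → ℤ)
    (hv : W *ᵥ v = 0) : W' *ᵥ v = 0 := by
  have h : (μ • W') *ᵥ v = 0 := by rw [hG, ← Matrix.mulVec_mulVec, hv, Matrix.mulVec_zero]
  rw [Matrix.smul_mulVec] at h
  exact (smul_eq_zero.mp h).resolve_left hμ

/-! ### Combinations of blocks lie in L_M -/

/-- `toFun` of an entrywise sum -/
theorem toFun_addL (n : ℕ) (a b : List ℤ) (ha : a.length = n) (hb : b.length = n) :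
    toFun n (addL a b) = toFun n a + toFun n b := by
  funext i
  simp only [toFun, Pi.add_apply]
  exact getD_addL a b i (by omega) (by omega)

/-- `toFun` of a scalar multiple -/
theorem toFun_smulL (n : ℕ) (c : ℤ) (a : List ℤ) : toFun n (smulL c a) = c • toFun n a := by
  funext i
  simp only [toFun, Pi.smul_apply, smul_eq_mul, smulL]
  exact getD_map_zero _ (mul_zero c) a i

/-- `toFun` of the zero list -/
theorem toFun_replicate_zero (n : ℕ) : toFun n (List.replicate n 0) = 0 := by
  funext i
  simp [toFun, List.getD_eq_getElem?_getD, i.2]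

/-- a combination of legitimate blocks lies in L_M -/
theorem comboVec_mem (M : ℕ) (l : List (ℤ × Block)) (hl : ∀ p ∈ l, Block.Legit M p.2) :
    toFun (M / 2) (comboVecL M l) ∈ L M := by
  induction l with
  | nil => simp only [comboVecL, List.foldr_nil]; rw [toFun_replicate_zero]; exact Submodule.zero_mem _
  | cons p l ih =>
    simp only [comboVecL, List.foldr_cons] at ih ⊢
    rw [toFun_addL _ _ _ (by rw [length_smulL, length_oddVecL]) (by
      have := length_comboVecL M l; simpa [comboVecL] using this), toFun_smulL]
    refine Submodule.add_mem _ (Submodule.smul_mem _ _ (Submodule.subset_span ⟨p.2, hl p (by simp), rfl⟩)) ?_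
    exact ih fun q hq => hl q (by simp [hq])


/-! ### Chunked Boolean checkers (one `decide +kernel` per chunk of rows) -/

/-- rows lo ≤ i < hi of A·Bᵀ + C·Dᵀ are the identity rows -/
def rowsOK (A B C D : List (List ℤ)) (c lo hi : ℕ) : Bool :=
  (List.range' lo (hi - lo)).all fun i => decide (sumRow A B C D c i = idRow c i)

/-- what `rowsOK` decides -/
theorem rowsOK_spec {A B C D : List (List ℤ)} {c lo hi : ℕ} (h : rowsOK A B C D c lo hi = true) :
    ∀ i, lo ≤ i → i < hi → sumRow A B C D c i = idRow c i := by
  intro i h1 h2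
  simp only [rowsOK, List.all_eq_true, List.mem_range'_1, decide_eq_true_eq] at h
  exact h i ⟨h1, by omega⟩

/-- rows lo ≤ i < hi: μ • (row i of W) = row i of G·B -/
def gOK (W G B : List (List ℤ)) (m c : ℕ) (μ : ℤ) (lo hi : ℕ) : Bool :=
  (List.range' lo (hi - lo)).all fun i => decide (smulL μ (W.getD i []) = prodRow G B m c i)

/-- what `gOK` decides -/
theorem gOK_spec {W G B : List (List ℤ)} {m c : ℕ} {μ : ℤ} {lo hi : ℕ} (h : gOK W G B m c μ lo hi = true) :
    ∀ i, lo ≤ i → i < hi → smulL μ (W.getD i []) = prodRow G B m c i := by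
  intro i h1 h2
  simp only [gOK, List.all_eq_true, List.mem_range'_1, decide_eq_true_eq] at h
  exact h i ⟨h1, by omega⟩

/-- generators lo ≤ j < hi: the row of Hg is the block combination and every block is legitimate -/
def bOK (M : ℕ) (Hg : List (List ℤ)) (blocks : List (List (ℤ × Block))) (lo hi : ℕ) : Bool :=
  (List.range' lo (hi - lo)).all fun j =>
    decide ((Hg.getD j []).take (M / 2) = comboVecL M (blocks.getD j [])) &&
      (blocks.getD j []).all fun p => decide (Block.Legit M p.2)

/-- what `bOK` decides -/
theorem bOK_spec {M : ℕ} {Hg : List (List ℤ)} {blocks : List (List (ℤ × Block))} {lo hi : ℕ}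
    (h : bOK M Hg blocks lo hi = true) :
    ∀ j, lo ≤ j → j < hi → (Hg.getD j []).take (M / 2) = comboVecL M (blocks.getD j []) ∧
      ∀ p ∈ blocks.getD j [], Block.Legit M p.2 := by
  intro j h1 h2
  simp only [bOK, List.all_eq_true, List.mem_range'_1, decide_eq_true_eq, Bool.and_eq_true] at h
  exact h j ⟨h1, by omega⟩

/-- two contiguous ranges of a statement make the union range -/
theorem spec_cat {P : ℕ → Prop} {lo mid hi : ℕ} (h1 : ∀ i, lo ≤ i → i < mid → P i)
    (h2 : ∀ i, mid ≤ i → i < hi → P i) : ∀ i, lo ≤ i → i < hi → P i := by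
  intro i hlo hhi
  by_cases hm : i < mid
  · exact h1 i hlo hm
  · exact h2 i (by omega) hhi

/-- a range statement from 0 as a bounded statement -/
theorem spec_lt {P : ℕ → Prop} {hi : ℕ} (h : ∀ i, 0 ≤ i → i < hi → P i) : ∀ i < hi, P i :=
  fun i hi => h i (Nat.zero_le _) hi

/-! ### The master lemma -/

/-- the certificate of «[H_M : L_M] = 1»: the generation certificate (HT, DT, C, WT; G, μ) and, for every generator,
a combination of legitimate blocks — then every vector of the augmented kernel projects into L_M -/
theorem index_one_of_cert (M r k' : ℕ) (Hg HT DT C Wp WT G : List (List ℤ)) (μ : ℤ) (hμ : μ ≠ 0)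
    (blocks : List (List (ℤ × Block)))
    (hHT : HT = transposeL Hg (M / 2 + 1) r) (hWT : WT = transposeL Wp (M / 2 + 1) k')
    (hDT : Lens DT (M / 2 + 1) r) (hC : Lens C (M / 2 + 1) k')
    (hrows : ∀ i < M / 2 + 1, sumRow HT DT C WT (M / 2 + 1) i = idRow (M / 2 + 1) i)
    (hG : ∀ i < k', smulL μ (Wp.getD i []) = prodRow G (augRows M) (kk M) (M / 2 + 1) i)
    (hB : ∀ j < r, (Hg.getD j []).take (M / 2) = comboVecL M (blocks.getD j []) ∧
      ∀ p ∈ blocks.getD j [], Block.Legit M p.2) :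
    ∀ v : Fin (M / 2 + 1) → ℤ, Wt M *ᵥ v = 0 → proj v ∈ L M := by
  intro v hv
  have hHTl : Lens HT (M / 2 + 1) r := by
    rw [hHT]; exact ⟨length_transposeL _ _ _, mem_transposeL_length _ _ _⟩
  have hWTl : Lens WT (M / 2 + 1) k' := by
    rw [hWT]; exact ⟨length_transposeL _ _ _, mem_transposeL_length _ _ _⟩
  have hI := identity_of_rows HT DT C WT (M / 2 + 1) r k' hHTl hDT hC hWTl hrows
  have hlink := smul_eq_mul_of_rows Wp G (augRows M) k' (kk M) (M / 2 + 1) μ hG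
  have hv' : matOf k' (M / 2 + 1) Wp *ᵥ v = 0 := kernel_of_link _ _ _ μ hμ hlink v hv
  have hv'' : (matOf (M / 2 + 1) k' WT)ᵀ *ᵥ v = 0 := by
    rw [hWT, matOf_transposeL, Matrix.transpose_transpose]; exact hv'
  have hvv := kernel_gen (matOf (M / 2 + 1) r HT) (matOf (M / 2 + 1) r DT)ᵀ (matOf (M / 2 + 1) k' C)
    (matOf (M / 2 + 1) k' WT)ᵀ hI v hv''
  set w := (matOf (M / 2 + 1) r DT)ᵀ *ᵥ v with hw
  have hproj : proj v = ∑ j : Fin r, w j • toFun (M / 2) ((Hg.getD j []).take (M / 2)) := by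
    funext a
    rw [proj, hvv, Finset.sum_apply]
    simp only [Matrix.mulVec, dotProduct, Pi.smul_apply, smul_eq_mul, matOf, Matrix.of_apply, hHT, transposeL,
      toFun]
    refine Finset.sum_congr rfl fun j _ => ?_
    rw [getD_map_range _ (M / 2 + 1) _ a.castSucc.2, getD_map_range _ r _ j.2, mul_comm]
    congr 1
    simp only [List.getD_eq_getElem?_getD, List.getElem?_take, Fin.val_castSucc]
    rw [if_pos a.2]
  rw [hproj]
  exact Submodule.sum_mem _ fun j _ => Submodule.smul_mem _ _ (by
    rw [(hB j j.2).1]; exact comboVec_mem M _ (hB j j.2).2)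

end HodgeRepro0.P5.DegreeIndexCert
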